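import Literature.Analysis.FunctionSpaces.L2TemperedDistribution
import HarnessLib

/-!
# The distributional Laplacian of a cut-off `C¹` function with a weak Laplacian

Analysis/FunctionSpaces support file (second of the chain discharging
`Literature.Analysis.FluidPDE.tsai1998_profile_smooth`, Tsai 1998, p. 33). The local elliptic
regularity step of the `H^s`-bootstrap (Folland, *Introduction to PDE*, 2nd ed., proof of the
Elliptic Regularity Theorem (6.33): "`L(ψ_{j+1}u) = ψ_{j+1} L u + [L, ψ_{j+1}] u`") needs, for
`L = Δ`, the commutator identity

  `Δ (χ P) = χ ΔP + 2 ∇χ·∇P + (Δχ) P`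

at the level of tempered distributions, when `P` is only `C¹` and `ΔP = q` holds weakly. This
file proves it (`laplacian_fnTD_mul_eq`): for `P ∈ C¹(E; ℂ)`, `q ∈ C⁰` with
`∫ P Σᵢ∂ᵢ∂ᵢψ = ∫ q ψ` for all smooth compactly supported `ψ`, and a smooth compactly supported
cut-off `χ`, the distributional Laplacian of `T_{χP}` is `T_{χq + 2Σᵢ∂ᵢχ∂ᵢP + (Σᵢ∂ᵢ∂ᵢχ)P}`
(sums over an orthonormal basis). Supporting calculus: the Leibniz rules
`fderiv_mul_apply_comm`, `fderiv_fderiv_mul_apply`, the frame formula for the Laplacian of a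
`C²` function (`laplacian_eq_sum_second_fderiv`; the tree's
`FluidPDE.laplacian_eq_sum_fderiv_fderiv(_normed)` in `WholeSpaceIBP`/`HeatDuhamelBack` are the
same formula behind heavy fluid imports, restated here for `ℂ`-valued functions to keep this
function-space file light), `∫ ∂ᵥG = 0` for `G ∈ C¹_c` and integration by parts against a
compactly supported factor (`integral_fderiv_apply_eq_zero_complex`,
`integral_mul_fderiv_apply_eq_neg`; `ℂ`-valued twins of `FluidPDE.integral_fderiv_apply_eq_zero`),
and the weak Laplacian of a `C²` function (`integral_mul_sum_fderiv_fderiv`).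

## References

* G. B. Folland, *Introduction to Partial Differential Equations*, 2nd ed. (1995), §6.C, proof
  of Theorem (6.33). [Folland1995PDE]
* T.-P. Tsai, ARMA 143 (1998), p. 33. [Tsai1998]
-/

noncomputable section

open MeasureTheory TemperedDistribution
open scoped ENNReal FourierTransform LineDeriv Laplacian Real SchwartzMap ContDiff

namespace Literature.Analysis.FunctionSpaces

variable {E : Type*} [NormedAddCommGroup E] [InnerProductSpace ℝ E] [FiniteDimensional ℝ E]
  [MeasurableSpace E] [BorelSpace E]

/-! ### Calculus helpers -/

omit [FiniteDimensional ℝ E] [MeasurableSpace E] [BorelSpace E] in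
/-- Leibniz rule for a directional derivative of a product of complex functions, written with
the factors in the order `∂c · d + c · ∂d`. [folklore] -/
theorem fderiv_mul_apply_comm {c d : E → ℂ} {x : E} (hc : DifferentiableAt ℝ c x)
    (hd : DifferentiableAt ℝ d x) (v : E) :
    fderiv ℝ (fun y => c y * d y) x v = fderiv ℝ c x v * d x + c x * fderiv ℝ d x v := by
  rw [fderiv_fun_mul hc hd]
  simp only [add_apply, FunLike.coe_smul, Pi.smul_apply,
    smul_eq_mul]
  ring

omit [FiniteDimensional ℝ E] [MeasurableSpace E] [BorelSpace E] in
/-- Second directional derivative of a product of `C²` functions: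
`∂ᵥ∂ᵥ(cd) = (∂ᵥ∂ᵥc) d + 2 ∂ᵥc ∂ᵥd + c ∂ᵥ∂ᵥd`. [folklore] -/
theorem fderiv_fderiv_mul_apply {c d : E → ℂ} (hc : ContDiff ℝ 2 c) (hd : ContDiff ℝ 2 d)
    (v : E) (x : E) :
    fderiv ℝ (fun y => fderiv ℝ (fun z => c z * d z) y v) x v =
      fderiv ℝ (fun y => fderiv ℝ c y v) x v * d x + 2 * (fderiv ℝ c x v * fderiv ℝ d x v) +
        c x * fderiv ℝ (fun y => fderiv ℝ d y v) x v := by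
  have hc1 : Differentiable ℝ c := hc.differentiable (by norm_num)
  have hd1 : Differentiable ℝ d := hd.differentiable (by norm_num)
  have hc' : Differentiable ℝ (fun y => fderiv ℝ c y v) :=
    ((hc.fderiv_right (m := 1) (by norm_num)).clm_apply contDiff_const).differentiable one_ne_zero
  have hd' : Differentiable ℝ (fun y => fderiv ℝ d y v) :=
    ((hd.fderiv_right (m := 1) (by norm_num)).clm_apply contDiff_const).differentiable one_ne_zero
  have h1 : (fun y => fderiv ℝ (fun z => c z * d z) y v) =
      fun y => fderiv ℝ c y v * d y + c y * fderiv ℝ d y v := by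
    funext y
    exact fderiv_mul_apply_comm (hc1 y) (hd1 y) v
  rw [h1, fderiv_fun_add ((hc' x).fun_mul (hd1 x)) ((hc1 x).fun_mul (hd' x)),
    _root_.add_apply, fderiv_mul_apply_comm (hc' x) (hd1 x),
    fderiv_mul_apply_comm (hc1 x) (hd' x)]
  ring

omit [MeasurableSpace E] [BorelSpace E] in
/-- The Laplacian of a `C²` function as the sum of pure second derivatives along an orthonormal
basis, `Δg(x) = Σᵢ ∂ᵢ∂ᵢ g(x)` (Mathlib `laplacian_eq_iteratedFDeriv_orthonormalBasis`; the
`ℂ`-valued case of the tree's `FluidPDE.laplacian_eq_sum_fderiv_fderiv_normed`). [folklore] -/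
theorem laplacian_eq_sum_second_fderiv {ι : Type*} [Fintype ι] (b : OrthonormalBasis ι ℝ E)
    {g : E → ℂ} (hg : ContDiff ℝ 2 g) (x : E) :
    Δ g x = ∑ i, fderiv ℝ (fun y => fderiv ℝ g y (b i)) x (b i) := by
  rw [InnerProductSpace.laplacian_eq_iteratedFDeriv_orthonormalBasis g b]
  refine Finset.sum_congr rfl fun i _ => ?_
  rw [iteratedFDeriv_two_apply, fderiv_clm_apply]
  · simp
  · exact ((hg.fderiv_right (m := 1) (by norm_num)).differentiable one_ne_zero) x
  · exact differentiableAt_const _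

/-- The integral of a directional derivative of a `C¹` compactly supported complex function
vanishes (integration by parts against the constant `1`; the `ℂ`-valued case of the tree's
`FluidPDE.integral_fderiv_apply_eq_zero`). [folklore] -/
theorem integral_fderiv_apply_eq_zero_complex {G : E → ℂ} (hG : ContDiff ℝ 1 G)
    (hGs : HasCompactSupport G) (v : E) : ∫ x, fderiv ℝ G x v = 0 := by
  have hGc : Continuous G := hG.continuous
  have hG'c : Continuous (fun x => fderiv ℝ G x v) :=
    (hG.continuous_fderiv one_ne_zero).clm_apply continuous_const
  have hG's : HasCompactSupport (fun x => fderiv ℝ G x v) := hGs.fderiv_apply (𝕜 := ℝ) v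
  have h := integral_bilinear_hasLineDerivAt_right_eq_neg_left_of_integrable
    (μ := (volume : Measure E)) (B := ContinuousLinearMap.mul ℝ ℂ) (f := G)
    (f' := fun x => fderiv ℝ G x v) (g := fun _ => (1 : ℂ)) (g' := fun _ => 0) (v := v)
    ?_ ?_ ?_ ?_ ?_
  · simpa using h
  · simpa using hG'c.integrable_of_hasCompactSupport hG's
  · simp
  · simpa using hGc.integrable_of_hasCompactSupport hGs
  · intro x _
    exact ((hG.differentiable one_ne_zero) x).hasFDerivAt.hasLineDerivAt v
  · intro x _
    exact (hasFDerivAt_const (1 : ℂ) x).hasLineDerivAt v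

/-- **Integration by parts** against a compactly supported `C¹` factor:
`∫ f ∂ᵥg = -∫ (∂ᵥf) g` for `f ∈ C¹`, `g ∈ C¹_c` (Mathlib's
`integral_bilinear_hasLineDerivAt_right_eq_neg_left_of_integrable`). [folklore] -/
theorem integral_mul_fderiv_apply_eq_neg {f g : E → ℂ} (hf : ContDiff ℝ 1 f) (hg : ContDiff ℝ 1 g)
    (hgs : HasCompactSupport g) (v : E) :
    ∫ x, f x * fderiv ℝ g x v = -∫ x, fderiv ℝ f x v * g x := by
  have hfc := hf.continuous
  have hgc := hg.continuous
  have hf'c : Continuous fun x => fderiv ℝ f x v :=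
    (hf.continuous_fderiv one_ne_zero).clm_apply continuous_const
  have hg'c : Continuous fun x => fderiv ℝ g x v :=
    (hg.continuous_fderiv one_ne_zero).clm_apply continuous_const
  have h := integral_bilinear_hasLineDerivAt_right_eq_neg_left_of_integrable
    (μ := (volume : Measure E)) (B := ContinuousLinearMap.mul ℝ ℂ) (f := f)
    (f' := fun x => fderiv ℝ f x v) (g := g) (g' := fun x => fderiv ℝ g x v) (v := v)
    ?_ ?_ ?_ ?_ ?_
  · simpa using h
  · exact (hf'c.mul hgc).integrable_of_hasCompactSupport hgs.mul_left
  · exact (hfc.mul hg'c).integrable_of_hasCompactSupport (hgs.fderiv_apply (𝕜 := ℝ) v).mul_left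
  · exact (hfc.mul hgc).integrable_of_hasCompactSupport hgs.mul_left
  · exact fun x _ => ((hf.differentiable one_ne_zero) x).hasFDerivAt.hasLineDerivAt v
  · exact fun x _ => ((hg.differentiable one_ne_zero) x).hasFDerivAt.hasLineDerivAt v

/-- A `C²` function has its classical Laplacian as weak Laplacian:
`∫ f Σᵢ∂ᵢ∂ᵢψ = ∫ (Σᵢ∂ᵢ∂ᵢf) ψ` for smooth compactly supported `ψ` (two integrations by parts).
[folklore] -/
theorem integral_mul_sum_fderiv_fderiv {ι : Type*} [Fintype ι] (b : OrthonormalBasis ι ℝ E)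
    {f : E → ℂ} (hf : ContDiff ℝ 2 f) (ψ : E → ℂ) (hψ : ContDiff ℝ ∞ ψ)
    (hψs : HasCompactSupport ψ) :
    ∫ x, f x * ∑ i, fderiv ℝ (fun y => fderiv ℝ ψ y (b i)) x (b i) =
      ∫ x, (∑ i, fderiv ℝ (fun y => fderiv ℝ f y (b i)) x (b i)) * ψ x := by
  have hf1 : ContDiff ℝ 1 f := hf.of_le (by norm_num)
  have hdf : ∀ i, ContDiff ℝ 1 (fun y => fderiv ℝ f y (b i)) := fun i =>
    (hf.fderiv_right (m := 1) (by norm_num)).clm_apply contDiff_const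
  have hψ1 : ContDiff ℝ 1 ψ := hψ.of_le (by exact_mod_cast le_top)
  have hdψ : ∀ i, ContDiff ℝ 1 (fun y => fderiv ℝ ψ y (b i)) := fun i =>
    ((hψ.fderiv_right (m := ∞) (by norm_cast)).clm_apply contDiff_const).of_le
      (by exact_mod_cast le_top)
  have hdψs : ∀ i, HasCompactSupport (fun y => fderiv ℝ ψ y (b i)) := fun i =>
    hψs.fderiv_apply (𝕜 := ℝ) (b i)
  have hddψc : ∀ i, Continuous (fun x => fderiv ℝ (fun y => fderiv ℝ ψ y (b i)) x (b i)) :=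
    fun i => ((hdψ i).continuous_fderiv one_ne_zero).clm_apply continuous_const
  have hddfc : ∀ i, Continuous (fun x => fderiv ℝ (fun y => fderiv ℝ f y (b i)) x (b i)) :=
    fun i => ((hdf i).continuous_fderiv one_ne_zero).clm_apply continuous_const
  have hI1 : ∀ i, Integrable (fun x => f x * fderiv ℝ (fun y => fderiv ℝ ψ y (b i)) x (b i))
      (volume : Measure E) := fun i =>
    (hf.continuous.mul (hddψc i)).integrable_of_hasCompactSupport
      ((hdψs i).fderiv_apply (𝕜 := ℝ) (b i)).mul_left
  have hI2 : ∀ i, Integrable (fun x => fderiv ℝ (fun y => fderiv ℝ f y (b i)) x (b i) * ψ x)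
      (volume : Measure E) := fun i =>
    ((hddfc i).mul hψ.continuous).integrable_of_hasCompactSupport hψs.mul_left
  simp_rw [Finset.mul_sum, Finset.sum_mul]
  rw [integral_finsetSum _ fun i _ => hI1 i, integral_finsetSum _ fun i _ => hI2 i]
  refine Finset.sum_congr rfl fun i _ => ?_
  rw [integral_mul_fderiv_apply_eq_neg hf1 (hdψ i) (hdψs i),
    integral_mul_fderiv_apply_eq_neg (hdf i) hψ1 hψs, neg_neg]

/-! ### The Laplacian of a cut-off function with a weak Laplacian -/

/-- **Localisation (commutator) identity for `Δ`.** If `P ∈ C¹` has the continuous weak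
Laplacian `q` (`∫ P Σᵢ∂ᵢ∂ᵢψ = ∫ q ψ` for all smooth compactly supported `ψ`) and `χ` is a smooth
compactly supported cut-off, then, in `𝓢'`,
`Δ T_{χP} = T_{χ q + 2 Σᵢ ∂ᵢχ ∂ᵢP + (Σᵢ ∂ᵢ∂ᵢχ) P}` — the identity
`Δ(χP) = χΔP + [Δ, χ]P`, `[Δ, χ]P = 2∇χ·∇P + (Δχ)P`, of the proof of the local elliptic
regularity theorem (Folland, *Introduction to PDE*, proof of (6.33)), here with `P` of class `C¹`
only. Proof: pair with a Schwartz `φ`, test the weak equation with `ψ = χφ`, expand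
`Σᵢ∂ᵢ∂ᵢ(χφ)` by Leibniz, and remove `Σᵢ ∂ᵢχ ∂ᵢφ` by one integration by parts
(`Pχ ΣᵢΔᵢφ = P ΣᵢΔᵢ(χφ) + [PΣᵢΔᵢχ + 2Σᵢ∂ᵢχ∂ᵢP] φ - 2 Σᵢ ∂ᵢ(P ∂ᵢχ φ)`).
[cite: Folland1995PDE, §6.C Theorem (6.33) (proof)] -/
theorem laplacian_fnTD_mul_eq {ι : Type*} [Fintype ι] (b : OrthonormalBasis ι ℝ E)
    {P q : E → ℂ} (hP : ContDiff ℝ 1 P) (hq : Continuous q)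
    (hPq : ∀ ψ : E → ℂ, ContDiff ℝ ∞ ψ → HasCompactSupport ψ →
      ∫ x, P x * ∑ i, fderiv ℝ (fun y => fderiv ℝ ψ y (b i)) x (b i) = ∫ x, q x * ψ x)
    {χ : E → ℂ} (hχ : ContDiff ℝ ∞ χ) (hχs : HasCompactSupport χ) :
    Δ (fnTD (fun x => χ x * P x)) =
      fnTD (fun x => χ x * q x + (2 * ∑ i, fderiv ℝ χ x (b i) * fderiv ℝ P x (b i) +
        (∑ i, fderiv ℝ (fun y => fderiv ℝ χ y (b i)) x (b i)) * P x)) := by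
  -- regularity bookkeeping
  have hPc : Continuous P := hP.continuous
  have hPd : Differentiable ℝ P := hP.differentiable one_ne_zero
  have hχc : Continuous χ := hχ.continuous
  have hχd : Differentiable ℝ χ := hχ.differentiable (by simp)
  have hdχ : ∀ i, ContDiff ℝ ∞ (fun x => fderiv ℝ χ x (b i)) := fun i =>
    (hχ.fderiv_right (m := ∞) (by norm_cast)).clm_apply contDiff_const
  have hdχs : ∀ i, HasCompactSupport (fun x => fderiv ℝ χ x (b i)) := fun i =>
    hχs.fderiv_apply (𝕜 := ℝ) (b i)
  have hddχs : ∀ i, HasCompactSupport (fun x => fderiv ℝ (fun y => fderiv ℝ χ y (b i)) x (b i)) :=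
    fun i => (hdχs i).fderiv_apply (𝕜 := ℝ) (b i)
  have hddχc : ∀ i, Continuous (fun x => fderiv ℝ (fun y => fderiv ℝ χ y (b i)) x (b i)) :=
    fun i => (((hdχ i).fderiv_right (m := ∞) (by norm_cast)).clm_apply contDiff_const).continuous
  have hdPc : ∀ i, Continuous (fun x => fderiv ℝ P x (b i)) := fun i =>
    (hP.continuous_fderiv one_ne_zero).clm_apply continuous_const
  -- the two L² memberships
  have hLs : HasCompactSupport (fun x => χ x * P x) := hχs.mul_right
  have hL : MemLp (fun x => χ x * P x) 2 (volume : Measure E) :=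
    (hχc.mul hPc).memLp_of_hasCompactSupport hLs
  set R : E → ℂ := fun x => 2 * ∑ i, fderiv ℝ χ x (b i) * fderiv ℝ P x (b i) +
        (∑ i, fderiv ℝ (fun y => fderiv ℝ χ y (b i)) x (b i)) * P x with hRdef
  have hRc : Continuous R := by
    refine (continuous_const.mul (continuous_finsetSum _ fun i _ => ?_)).add
      ((continuous_finsetSum _ fun i _ => hddχc i).mul hPc)
    exact ((hdχ i).continuous).mul (hdPc i)
  have hRs : HasCompactSupport R := by
    refine HasCompactSupport.intro hχs fun x hx => ?_
    have h1 : ∀ i, fderiv ℝ χ x (b i) = 0 := fun i => by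
      rw [notMem_tsupport_iff_eventuallyEq.mp hx |>.fderiv_eq]
      simp
    have h2 : ∀ i, fderiv ℝ (fun y => fderiv ℝ χ y (b i)) x (b i) = 0 := fun i => by
      have hx' : x ∉ tsupport (fun y => fderiv ℝ χ y (b i)) := fun h =>
        hx (tsupport_fderiv_apply_subset ℝ (b i) h)
      rw [notMem_tsupport_iff_eventuallyEq.mp hx' |>.fderiv_eq]
      simp
    simp [hRdef, h1, h2]
  have hRL : MemLp (fun x => χ x * q x + R x) 2 (volume : Measure E) :=
    ((hχc.mul hq).add hRc).memLp_of_hasCompactSupport ((hχs.mul_right (f' := q)).add hRs)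
  ext φ
  rw [laplacian_apply_apply, fnTD_apply hL, fnTD_apply hRL]
  -- the test function `ψ = χ φ` and its second derivatives
  have hφ : ContDiff ℝ ∞ (φ : E → ℂ) := φ.smooth ⊤
  set ψ : E → ℂ := fun z => χ z * φ z with hψdef
  have hψ : ContDiff ℝ ∞ ψ := hχ.mul hφ
  have hψs : HasCompactSupport ψ := hχs.mul_right
  set DD : ι → E → ℂ := fun i x => fderiv ℝ (fun y => fderiv ℝ ψ y (b i)) x (b i) with hDDdef
  have hDDc : ∀ i, Continuous (DD i) := fun i =>
    ((((hψ.fderiv_right (m := ∞) (by norm_cast)).clm_apply contDiff_const).fderiv_right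
      (m := ∞) (by norm_cast)).clm_apply contDiff_const).continuous
  have hDDs : ∀ i, HasCompactSupport (DD i) := fun i =>
    (hψs.fderiv_apply (𝕜 := ℝ) (b i)).fderiv_apply (𝕜 := ℝ) (b i)
  -- the boundary terms `G i = P ∂ᵢχ φ`
  set G : ι → E → ℂ := fun i y => P y * (fderiv ℝ χ y (b i) * φ y) with hGdef
  have hG1 : ∀ i, ContDiff ℝ 1 (G i) := fun i =>
    hP.mul (((hdχ i).mul hφ).of_le (by norm_cast))
  have hGs : ∀ i, HasCompactSupport (G i) := fun i =>
    ((hdχs i).mul_right (f' := fun y => φ y)).mul_left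
  have hW : ∀ i x, fderiv ℝ (G i) x (b i) = fderiv ℝ P x (b i) * (fderiv ℝ χ x (b i) * φ x) +
      P x * (fderiv ℝ (fun y => fderiv ℝ χ y (b i)) x (b i) * φ x +
        fderiv ℝ χ x (b i) * fderiv ℝ φ x (b i)) := by
    intro i x
    have hd1 : DifferentiableAt ℝ (fun y => fderiv ℝ χ y (b i)) x :=
      ((hdχ i).differentiable (by simp)) x
    have hd2 : DifferentiableAt ℝ (fun y => φ y) x := φ.differentiableAt
    rw [hGdef, fderiv_mul_apply_comm (hPd x) (hd1.fun_mul hd2), fderiv_mul_apply_comm hd1 hd2]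
  have hχφ : ∀ i x, DD i x = fderiv ℝ (fun y => fderiv ℝ χ y (b i)) x (b i) * φ x +
      2 * (fderiv ℝ χ x (b i) * fderiv ℝ φ x (b i)) +
        χ x * fderiv ℝ (fun y => fderiv ℝ φ y (b i)) x (b i) := fun i x =>
    fderiv_fderiv_mul_apply (hχ.of_le (by norm_cast)) (hφ.of_le (by norm_cast)) (b i) x
  have hΔφ : ∀ x, (Δ φ) x = ∑ i, fderiv ℝ (fun y => fderiv ℝ φ y (b i)) x (b i) := fun x => by
    rw [SchwartzMap.laplacian_apply, laplacian_eq_sum_second_fderiv b (φ.smooth 2)]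
  -- the pointwise identity
  have hpt : ∀ x, (Δ φ) x * (χ x * P x) =
      (∑ i, P x * DD i x) + φ x * R x - 2 * ∑ i, fderiv ℝ (G i) x (b i) := by
    intro x
    have hterm : ∀ i, fderiv ℝ (fun y => fderiv ℝ φ y (b i)) x (b i) * (χ x * P x) =
        P x * DD i x + φ x * (2 * (fderiv ℝ χ x (b i) * fderiv ℝ P x (b i)) +
          fderiv ℝ (fun y => fderiv ℝ χ y (b i)) x (b i) * P x) -
          2 * fderiv ℝ (G i) x (b i) := by
      intro i
      rw [hW, hχφ]
      ring
    rw [hΔφ x, Finset.sum_mul, Finset.sum_congr rfl (fun i _ => hterm i),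
      Finset.sum_sub_distrib, Finset.sum_add_distrib, ← Finset.mul_sum, ← Finset.mul_sum]
    simp only [hRdef, Finset.sum_add_distrib, Finset.mul_sum, Finset.sum_mul]
  -- integrability of the three groups
  have hI1 : ∀ i, Integrable (fun x => P x * DD i x) (volume : Measure E) := fun i =>
    (hPc.mul (hDDc i)).integrable_of_hasCompactSupport (hDDs i).mul_left
  have hI2 : Integrable (fun x => φ x * R x) (volume : Measure E) :=
    (φ.continuous.mul hRc).integrable_of_hasCompactSupport hRs.mul_left
  have hI3 : ∀ i, Integrable (fun x => fderiv ℝ (G i) x (b i)) (volume : Measure E) := fun i =>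
    (((hG1 i).continuous_fderiv one_ne_zero).clm_apply continuous_const)
      |>.integrable_of_hasCompactSupport ((hGs i).fderiv_apply (𝕜 := ℝ) (b i))
  have hI4 : Integrable (fun x => φ x * (χ x * q x)) (volume : Measure E) :=
    (φ.continuous.mul (hχc.mul hq)).integrable_of_hasCompactSupport
      (hχs.mul_right (f' := q)).mul_left
  -- use the weak equation with the test function `ψ`
  have hkey : ∫ x, ∑ i, P x * DD i x = ∫ x, q x * ψ x := by
    rw [← hPq ψ hψ hψs]
    exact integral_congr_ae (Filter.Eventually.of_forall fun x => by
      simp only [hDDdef, Finset.mul_sum])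
  have hA : Integrable (fun x => (∑ i, P x * DD i x) + φ x * R x) (volume : Measure E) := by
    have := (integrable_finsetSum (s := Finset.univ) fun i _ => hI1 i).add hI2
    exact this
  have hB : Integrable (fun x => 2 * ∑ i, fderiv ℝ (G i) x (b i)) (volume : Measure E) := by
    have := (integrable_finsetSum (s := Finset.univ) fun i _ => hI3 i).const_mul 2
    exact this
  have hq' : ∫ x, q x * ψ x = ∫ x, φ x * (χ x * q x) :=
    integral_congr_ae (Filter.Eventually.of_forall fun x => by simp only [hψdef]; ring)
  calc ∫ x, (Δ φ) x * (χ x * P x)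
      = ∫ x, ((∑ i, P x * DD i x) + φ x * R x - 2 * ∑ i, fderiv ℝ (G i) x (b i)) :=
        integral_congr_ae (Filter.Eventually.of_forall hpt)
    _ = (∫ x, ∑ i, P x * DD i x) + (∫ x, φ x * R x) -
          ∫ x, 2 * ∑ i, fderiv ℝ (G i) x (b i) := by
        rw [integral_sub hA hB, integral_add (integrable_finsetSum _ fun i _ => hI1 i) hI2]
    _ = (∫ x, φ x * (χ x * q x)) + (∫ x, φ x * R x) := by
        rw [hkey, hq', integral_const_mul, integral_finsetSum _ fun i _ => hI3 i]
        simp [integral_fderiv_apply_eq_zero_complex (hG1 _) (hGs _)]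
    _ = ∫ x, φ x * (χ x * q x + R x) := by
        rw [← integral_add hI4 hI2]
        exact integral_congr_ae (Filter.Eventually.of_forall fun x => by ring)


end Literature.Analysis.FunctionSpaces
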